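import Summits.FinalStateConjecture.FinalStateConjecture.Theorems.EIHFluxBalanceInertialRecessionStubRechart3Window
import Summits.FinalStateConjecture.FinalStateConjecture.Theorems.EIHFluxBalanceInertialRecessionStubRechart3Profile

/-!
# Route EIHFluxBalance — `InertialRecession`, re-charting: the admissible clamp profile

Helper file for the crux `stmt-FinalStateConjecture-10166`
(`Summit.FinalStateConjecture.FinalStateConjecture.Theses.EIHFluxBalance.InertialRecession`),
line `sublinear-is-free-clean-window-charges`, stub `stub_rechart` (the transfer P2), part G1.

The clamp radius `ρ'(s) = ρ(s) + ρmin` of the clock chart at model time `s` must be ADMISSIBLE: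
(LATE) the lab time of every clamped chart point exceeds `T_late`; (INJ) the tilt varies slowly
after lab time `T₀ s` relative to `2ρ'`; (DER) all frame/centre data are in a `δ`-window with
`δ ~ 1/(γ⁴ (1 + 2ρ')⁴)` after lab time `T₀(s−1) − 8γρ'`; (SEP) the other centres are farther than
the chart's spatial extent `2(4γ+16γ²)ρ'` plus their horizon size at all lab times `≥ T₀ s − 8γρ'`;
(SUB) `ρ'² ≤ s`. Each condition is antitone in `ρ` and holds at all late `s` for every FIXED `ρ`
(`eventually_admissible`), so `exists_slow_profile` (`…Profile`) yields a smooth admissible profile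
(`exists_admissible_profile`). [folklore]
-/

noncomputable section

set_option linter.dupNamespace false

open Set Filter Function Metric Topology TopologicalSpace
open scoped ContDiff
open Literature.Geometry.Lorentzian

namespace Summit.FinalStateConjecture.FinalStateConjecture.Theorems.SublinearIsFree.Rechart

section Admissible

variable {N : ℕ} (i : Fin N) (M a : Fin N → ℝ) (ξ : Fin N → ℝ → E3) (Λt : ℝ → lorentzGroup) (T₀ : ℝ → ℝ)
  (hΛt : ContDiff ℝ ∞ (fun t ↦ ((Λt t : E4 ≃L[ℝ] E4) : E4 →L[ℝ] E4)))
  (hdec : ∀ m, 1 ≤ m → m ≤ 3 → Tendsto (fun t ↦ iteratedDeriv m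
    (fun s ↦ ((Λt s : E4 ≃L[ℝ] E4) : E4 →L[ℝ] E4)) t) atTop (𝓝 0))
  {γ : ℝ} (hγ1 : 1 ≤ γ) (huγ : ∀ t, |((Λt t : E4 ≃L[ℝ] E4) (E4.basisVector 0)) 0| ≤ γ)
  (hpos : ∀ t, 0 < ((Λt t : E4 ≃L[ℝ] E4) (E4.basisVector 0)) 0) (hξ : ContDiff ℝ ∞ (ξ i))
  (hmis : ∀ m : ℕ, m ≤ 2 → Tendsto (fun t ↦ iteratedDeriv m (fun s ↦ deriv (ξ i) s -
    ((((Λt s : E4 ≃L[ℝ] E4) (E4.basisVector 0)) 0)⁻¹ •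
      E4.spatial ((Λt s : E4 ≃L[ℝ] E4) (E4.basisVector 0)))) t) atTop (𝓝 0))
  (hsep : ∀ j ≠ i, Tendsto (fun t ↦ ‖ξ i t - ξ j t‖) atTop atTop)
  (hT₀inf : Tendsto T₀ atTop atTop)

include hΛt hdec huγ hpos hξ hmis hsep hT₀inf hγ1 in
-- five families of eventual conditions
set_option maxHeartbeats 800000 in
/-- **Every fixed clamp radius is eventually admissible.** See the module docstring for the five
conditions; `ρmin` is the floor of the clamp radius and `Tl` the required lab time. [folklore] -/
theorem eventually_admissible (ρmin Tl : ℝ) (hρmin : 0 ≤ ρmin) (n : ℕ) : ∀ᶠ s in atTop,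
    (Tl + 1 ≤ T₀ s - 8 * γ * (n + ρmin)) ∧
    (∀ t, T₀ s ≤ t → ‖deriv (fun t ↦ frameTilt (Λt t)) t‖ * (2 * (n + ρmin)) ≤ 1 / 2) ∧
    (∀ t, T₀ (s - 1) - 8 * γ * (n + ρmin) ≤ t →
      ‖deriv (fun t ↦ frameVel (Λt t) 0) t‖ ≤ 1 / (664 * γ ^ 4 * (1 + 2 * (n + ρmin)) ^ 4 + 1) ∧
      ‖iteratedDeriv 2 (fun t ↦ frameVel (Λt t) 0) t‖ ≤ 1 / (664 * γ ^ 4 * (1 + 2 * (n + ρmin)) ^ 4 + 1) ∧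
      ‖deriv (fun t ↦ frameTilt (Λt t)) t‖ ≤ 1 / (664 * γ ^ 4 * (1 + 2 * (n + ρmin)) ^ 4 + 1) ∧
      ‖iteratedDeriv 2 (fun t ↦ frameTilt (Λt t)) t‖ ≤ 1 / (664 * γ ^ 4 * (1 + 2 * (n + ρmin)) ^ 4 + 1) ∧
      ‖iteratedDeriv 3 (fun t ↦ frameTilt (Λt t)) t‖ ≤ 1 / (664 * γ ^ 4 * (1 + 2 * (n + ρmin)) ^ 4 + 1) ∧
      ‖deriv (fun t ↦ purgedFrame (Λt t)) t‖ ≤ 1 / (664 * γ ^ 4 * (1 + 2 * (n + ρmin)) ^ 4 + 1) ∧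
      ‖iteratedDeriv 2 (fun t ↦ purgedFrame (Λt t)) t‖ ≤ 1 / (664 * γ ^ 4 * (1 + 2 * (n + ρmin)) ^ 4 + 1) ∧
      ‖iteratedDeriv 3 (fun t ↦ purgedFrame (Λt t)) t‖ ≤ 1 / (664 * γ ^ 4 * (1 + 2 * (n + ρmin)) ^ 4 + 1) ∧
      ‖deriv (centrePath (ξ i)) t - normVel (Λt t)‖ ≤ 1 / (664 * γ ^ 4 * (1 + 2 * (n + ρmin)) ^ 4 + 1) ∧
      ‖iteratedDeriv 2 (centrePath (ξ i)) t‖ ≤ 1 / (664 * γ ^ 4 * (1 + 2 * (n + ρmin)) ^ 4 + 1) ∧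
      ‖iteratedDeriv 3 (centrePath (ξ i)) t‖ ≤ 1 / (664 * γ ^ 4 * (1 + 2 * (n + ρmin)) ^ 4 + 1)) ∧
    (∀ t, T₀ s - 8 * γ * (n + ρmin) ≤ t → ∀ j ≠ i,
      2 * (4 * γ + (4 * γ) ^ 2) * (n + ρmin) + Kerr.rPlus (M j) (a j) + |a j| + 1 ≤ ‖ξ i t - ξ j t‖) ∧
    ((n + ρmin) ^ 2 ≤ s) := by
  have hγ0 : 0 ≤ γ := zero_le_one.trans hγ1
  set K : ℝ := n + ρmin with hK
  have hK0 : 0 ≤ K := by positivity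
  -- thresholds in the lab time
  have hT₀late : ∀ b : ℝ, ∀ᶠ s in atTop, b ≤ T₀ s := fun b ↦ hT₀inf.eventually (eventually_ge_atTop b)
  have hT₀late' : ∀ b : ℝ, ∀ᶠ s in atTop, b ≤ T₀ (s - 1) := fun b ↦ by
    have h := hT₀inf.comp (tendsto_atTop_add_const_right atTop (-1) tendsto_id)
    filter_upwards [h.eventually (eventually_ge_atTop b)] with s hs
    simpa [sub_eq_add_neg] using hs
  -- (LATE)
  have e1 : ∀ᶠ s in atTop, Tl + 1 ≤ T₀ s - 8 * γ * K := by
    filter_upwards [hT₀late (Tl + 1 + 8 * γ * K)] with s hs; linarith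
  -- (INJ)
  have e2 : ∀ᶠ s in atTop, ∀ t, T₀ s ≤ t → ‖deriv (fun t ↦ frameTilt (Λt t)) t‖ * (2 * K) ≤ 1 / 2 := by
    have hpos' : (0 : ℝ) < 1 / (4 * K + 1) := by positivity
    obtain ⟨S, -, -, hL', -⟩ := exists_window Λt (ξ i) hΛt hdec huγ hpos hξ hmis hpos'
    filter_upwards [hT₀late S] with s hs t ht
    have h1 := hL' t (hs.trans ht)
    have h2 : 1 / (4 * K + 1) * (2 * K) ≤ 1 / 2 := by
      rw [div_mul_eq_mul_div, one_mul, div_le_iff₀ (by positivity)]; linarith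
    exact (mul_le_mul_of_nonneg_right h1 (by positivity)).trans h2
  -- (DER)
  have e3 : ∀ᶠ s in atTop, ∀ t, T₀ (s - 1) - 8 * γ * K ≤ t →
      ‖deriv (fun t ↦ frameVel (Λt t) 0) t‖ ≤ 1 / (664 * γ ^ 4 * (1 + 2 * K) ^ 4 + 1) ∧
      ‖iteratedDeriv 2 (fun t ↦ frameVel (Λt t) 0) t‖ ≤ 1 / (664 * γ ^ 4 * (1 + 2 * K) ^ 4 + 1) ∧
      ‖deriv (fun t ↦ frameTilt (Λt t)) t‖ ≤ 1 / (664 * γ ^ 4 * (1 + 2 * K) ^ 4 + 1) ∧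
      ‖iteratedDeriv 2 (fun t ↦ frameTilt (Λt t)) t‖ ≤ 1 / (664 * γ ^ 4 * (1 + 2 * K) ^ 4 + 1) ∧
      ‖iteratedDeriv 3 (fun t ↦ frameTilt (Λt t)) t‖ ≤ 1 / (664 * γ ^ 4 * (1 + 2 * K) ^ 4 + 1) ∧
      ‖deriv (fun t ↦ purgedFrame (Λt t)) t‖ ≤ 1 / (664 * γ ^ 4 * (1 + 2 * K) ^ 4 + 1) ∧
      ‖iteratedDeriv 2 (fun t ↦ purgedFrame (Λt t)) t‖ ≤ 1 / (664 * γ ^ 4 * (1 + 2 * K) ^ 4 + 1) ∧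
      ‖iteratedDeriv 3 (fun t ↦ purgedFrame (Λt t)) t‖ ≤ 1 / (664 * γ ^ 4 * (1 + 2 * K) ^ 4 + 1) ∧
      ‖deriv (centrePath (ξ i)) t - normVel (Λt t)‖ ≤ 1 / (664 * γ ^ 4 * (1 + 2 * K) ^ 4 + 1) ∧
      ‖iteratedDeriv 2 (centrePath (ξ i)) t‖ ≤ 1 / (664 * γ ^ 4 * (1 + 2 * K) ^ 4 + 1) ∧
      ‖iteratedDeriv 3 (centrePath (ξ i)) t‖ ≤ 1 / (664 * γ ^ 4 * (1 + 2 * K) ^ 4 + 1) := by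
    have hpos' : (0 : ℝ) < 1 / (664 * γ ^ 4 * (1 + 2 * K) ^ 4 + 1) := by positivity
    obtain ⟨S, hu', hu'', hL', hL'', hL''', hP', hP'', hP''', hc', hc'', hc''', -, -⟩ :=
      exists_window Λt (ξ i) hΛt hdec huγ hpos hξ hmis hpos'
    filter_upwards [hT₀late' (S + 8 * γ * K)] with s hs t ht
    have hSt : S ≤ t := by linarith
    exact ⟨hu' t hSt, hu'' t hSt, hL' t hSt, hL'' t hSt, hL''' t hSt, hP' t hSt, hP'' t hSt, hP''' t hSt,
      hc' t hSt, hc'' t hSt, hc''' t hSt⟩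
  -- (SEP)
  have e4 : ∀ᶠ s in atTop, ∀ t, T₀ s - 8 * γ * K ≤ t → ∀ j ≠ i,
      2 * (4 * γ + (4 * γ) ^ 2) * K + Kerr.rPlus (M j) (a j) + |a j| + 1 ≤ ‖ξ i t - ξ j t‖ := by
    have hj : ∀ j, ∀ᶠ t in atTop, j ≠ i →
        2 * (4 * γ + (4 * γ) ^ 2) * K + Kerr.rPlus (M j) (a j) + |a j| + 1 ≤ ‖ξ i t - ξ j t‖ := by
      intro j
      by_cases h : j = i
      · exact Eventually.of_forall fun t hji ↦ (hji h).elim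
      · exact ((hsep j h).eventually (eventually_ge_atTop _)).mono fun t ht _ ↦ ht
    obtain ⟨S₂, hS₂⟩ := eventually_atTop.mp (eventually_all.mpr hj)
    filter_upwards [hT₀late (S₂ + 8 * γ * K)] with s hs t ht j hji
    exact hS₂ t (by linarith) j hji
  -- (SUB)
  have e5 : ∀ᶠ s in atTop, K ^ 2 ≤ s := eventually_ge_atTop _
  filter_upwards [e1, e2, e3, e4, e5] with s h1 h2 h3 h4 h5
  exact ⟨h1, h2, h3, h4, h5⟩

end Admissible


section Profile

variable {N : ℕ} (i : Fin N) (M a : Fin N → ℝ) (ξ : Fin N → ℝ → E3) (Λt : ℝ → lorentzGroup) (T₀ : ℝ → ℝ)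
  (hΛt : ContDiff ℝ ∞ (fun t ↦ ((Λt t : E4 ≃L[ℝ] E4) : E4 →L[ℝ] E4)))
  (hdec : ∀ m, 1 ≤ m → m ≤ 3 → Tendsto (fun t ↦ iteratedDeriv m
    (fun s ↦ ((Λt s : E4 ≃L[ℝ] E4) : E4 →L[ℝ] E4)) t) atTop (𝓝 0))
  {γ : ℝ} (hγ1 : 1 ≤ γ) (huγ : ∀ t, |((Λt t : E4 ≃L[ℝ] E4) (E4.basisVector 0)) 0| ≤ γ)
  (hpos : ∀ t, 0 < ((Λt t : E4 ≃L[ℝ] E4) (E4.basisVector 0)) 0) (hξ : ContDiff ℝ ∞ (ξ i))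
  (hmis : ∀ m : ℕ, m ≤ 2 → Tendsto (fun t ↦ iteratedDeriv m (fun s ↦ deriv (ξ i) s -
    ((((Λt s : E4 ≃L[ℝ] E4) (E4.basisVector 0)) 0)⁻¹ •
      E4.spatial ((Λt s : E4 ≃L[ℝ] E4) (E4.basisVector 0)))) t) atTop (𝓝 0))
  (hsep : ∀ j ≠ i, Tendsto (fun t ↦ ‖ξ i t - ξ j t‖) atTop atTop)
  (hT₀inf : Tendsto T₀ atTop atTop)

include hγ1 in
-- monotonicity bookkeeping of the five conditions
set_option maxHeartbeats 800000 in
/-- The admissibility conditions are antitone in the clamp radius. [folklore] -/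
theorem admissible_antitone (ρmin Tl : ℝ) (hρmin : 0 ≤ ρmin) (s r r' : ℝ) (hrr : r' ≤ r)
    (h : (Tl + 1 ≤ T₀ s - 8 * γ * (max r 0 + ρmin)) ∧
    (∀ t, T₀ s ≤ t → ‖deriv (fun t ↦ frameTilt (Λt t)) t‖ * (2 * (max r 0 + ρmin)) ≤ 1 / 2) ∧
    (∀ t, T₀ (s - 1) - 8 * γ * (max r 0 + ρmin) ≤ t →
      ‖deriv (fun t ↦ frameVel (Λt t) 0) t‖ ≤ 1 / (664 * γ ^ 4 * (1 + 2 * (max r 0 + ρmin)) ^ 4 + 1) ∧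
      ‖iteratedDeriv 2 (fun t ↦ frameVel (Λt t) 0) t‖ ≤ 1 / (664 * γ ^ 4 * (1 + 2 * (max r 0 + ρmin)) ^ 4 + 1) ∧
      ‖deriv (fun t ↦ frameTilt (Λt t)) t‖ ≤ 1 / (664 * γ ^ 4 * (1 + 2 * (max r 0 + ρmin)) ^ 4 + 1) ∧
      ‖iteratedDeriv 2 (fun t ↦ frameTilt (Λt t)) t‖ ≤ 1 / (664 * γ ^ 4 * (1 + 2 * (max r 0 + ρmin)) ^ 4 + 1) ∧
      ‖iteratedDeriv 3 (fun t ↦ frameTilt (Λt t)) t‖ ≤ 1 / (664 * γ ^ 4 * (1 + 2 * (max r 0 + ρmin)) ^ 4 + 1) ∧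
      ‖deriv (fun t ↦ purgedFrame (Λt t)) t‖ ≤ 1 / (664 * γ ^ 4 * (1 + 2 * (max r 0 + ρmin)) ^ 4 + 1) ∧
      ‖iteratedDeriv 2 (fun t ↦ purgedFrame (Λt t)) t‖ ≤ 1 / (664 * γ ^ 4 * (1 + 2 * (max r 0 + ρmin)) ^ 4 + 1) ∧
      ‖iteratedDeriv 3 (fun t ↦ purgedFrame (Λt t)) t‖ ≤ 1 / (664 * γ ^ 4 * (1 + 2 * (max r 0 + ρmin)) ^ 4 + 1) ∧
      ‖deriv (centrePath (ξ i)) t - normVel (Λt t)‖ ≤ 1 / (664 * γ ^ 4 * (1 + 2 * (max r 0 + ρmin)) ^ 4 + 1) ∧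
      ‖iteratedDeriv 2 (centrePath (ξ i)) t‖ ≤ 1 / (664 * γ ^ 4 * (1 + 2 * (max r 0 + ρmin)) ^ 4 + 1) ∧
      ‖iteratedDeriv 3 (centrePath (ξ i)) t‖ ≤ 1 / (664 * γ ^ 4 * (1 + 2 * (max r 0 + ρmin)) ^ 4 + 1)) ∧
    (∀ t, T₀ s - 8 * γ * (max r 0 + ρmin) ≤ t → ∀ j ≠ i,
      2 * (4 * γ + (4 * γ) ^ 2) * (max r 0 + ρmin) + Kerr.rPlus (M j) (a j) + |a j| + 1 ≤ ‖ξ i t - ξ j t‖) ∧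
    ((max r 0 + ρmin) ^ 2 ≤ s)) :
    (Tl + 1 ≤ T₀ s - 8 * γ * (max r' 0 + ρmin)) ∧
    (∀ t, T₀ s ≤ t → ‖deriv (fun t ↦ frameTilt (Λt t)) t‖ * (2 * (max r' 0 + ρmin)) ≤ 1 / 2) ∧
    (∀ t, T₀ (s - 1) - 8 * γ * (max r' 0 + ρmin) ≤ t →
      ‖deriv (fun t ↦ frameVel (Λt t) 0) t‖ ≤ 1 / (664 * γ ^ 4 * (1 + 2 * (max r' 0 + ρmin)) ^ 4 + 1) ∧
      ‖iteratedDeriv 2 (fun t ↦ frameVel (Λt t) 0) t‖ ≤ 1 / (664 * γ ^ 4 * (1 + 2 * (max r' 0 + ρmin)) ^ 4 + 1) ∧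
      ‖deriv (fun t ↦ frameTilt (Λt t)) t‖ ≤ 1 / (664 * γ ^ 4 * (1 + 2 * (max r' 0 + ρmin)) ^ 4 + 1) ∧
      ‖iteratedDeriv 2 (fun t ↦ frameTilt (Λt t)) t‖ ≤ 1 / (664 * γ ^ 4 * (1 + 2 * (max r' 0 + ρmin)) ^ 4 + 1) ∧
      ‖iteratedDeriv 3 (fun t ↦ frameTilt (Λt t)) t‖ ≤ 1 / (664 * γ ^ 4 * (1 + 2 * (max r' 0 + ρmin)) ^ 4 + 1) ∧
      ‖deriv (fun t ↦ purgedFrame (Λt t)) t‖ ≤ 1 / (664 * γ ^ 4 * (1 + 2 * (max r' 0 + ρmin)) ^ 4 + 1) ∧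
      ‖iteratedDeriv 2 (fun t ↦ purgedFrame (Λt t)) t‖ ≤ 1 / (664 * γ ^ 4 * (1 + 2 * (max r' 0 + ρmin)) ^ 4 + 1) ∧
      ‖iteratedDeriv 3 (fun t ↦ purgedFrame (Λt t)) t‖ ≤ 1 / (664 * γ ^ 4 * (1 + 2 * (max r' 0 + ρmin)) ^ 4 + 1) ∧
      ‖deriv (centrePath (ξ i)) t - normVel (Λt t)‖ ≤ 1 / (664 * γ ^ 4 * (1 + 2 * (max r' 0 + ρmin)) ^ 4 + 1) ∧
      ‖iteratedDeriv 2 (centrePath (ξ i)) t‖ ≤ 1 / (664 * γ ^ 4 * (1 + 2 * (max r' 0 + ρmin)) ^ 4 + 1) ∧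
      ‖iteratedDeriv 3 (centrePath (ξ i)) t‖ ≤ 1 / (664 * γ ^ 4 * (1 + 2 * (max r' 0 + ρmin)) ^ 4 + 1)) ∧
    (∀ t, T₀ s - 8 * γ * (max r' 0 + ρmin) ≤ t → ∀ j ≠ i,
      2 * (4 * γ + (4 * γ) ^ 2) * (max r' 0 + ρmin) + Kerr.rPlus (M j) (a j) + |a j| + 1 ≤ ‖ξ i t - ξ j t‖) ∧
    ((max r' 0 + ρmin) ^ 2 ≤ s) := by
  have hγ0 : 0 ≤ γ := zero_le_one.trans hγ1
  obtain ⟨h1, h2, h3, h4, h5⟩ := h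
  have hKK : max r' 0 + ρmin ≤ max r 0 + ρmin := by
    have := max_le_max hrr (le_refl (0:ℝ)); linarith
  have hK'0 : 0 ≤ max r' 0 + ρmin := add_nonneg (le_max_right _ _) hρmin
  have hγK : 8 * γ * (max r' 0 + ρmin) ≤ 8 * γ * (max r 0 + ρmin) := mul_le_mul_of_nonneg_left hKK (by positivity)
  have hD : 1 / (664 * γ ^ 4 * (1 + 2 * (max r 0 + ρmin)) ^ 4 + 1) ≤
      1 / (664 * γ ^ 4 * (1 + 2 * (max r' 0 + ρmin)) ^ 4 + 1) := by
    refine one_div_le_one_div_of_le (by positivity) ?_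
    have : (1 + 2 * (max r' 0 + ρmin)) ^ 4 ≤ (1 + 2 * (max r 0 + ρmin)) ^ 4 :=
      pow_le_pow_left₀ (by linarith) (by linarith) 4
    nlinarith [pow_nonneg hγ0 4]
  refine ⟨by linarith, fun t ht ↦ ?_, fun t ht ↦ ?_, fun t ht j hj ↦ ?_, ?_⟩
  · have := h2 t ht
    have hm : ‖deriv (fun t ↦ frameTilt (Λt t)) t‖ * (2 * (max r' 0 + ρmin)) ≤
        ‖deriv (fun t ↦ frameTilt (Λt t)) t‖ * (2 * (max r 0 + ρmin)) :=
      mul_le_mul_of_nonneg_left (by linarith) (norm_nonneg _)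
    linarith
  · obtain ⟨b1, b2, b3, b4, b5, b6, b7, b8, b9, b10, b11⟩ := h3 t (by linarith)
    exact ⟨b1.trans hD, b2.trans hD, b3.trans hD, b4.trans hD, b5.trans hD, b6.trans hD, b7.trans hD, b8.trans hD,
      b9.trans hD, b10.trans hD, b11.trans hD⟩
  · have := h4 t (by linarith) j hj
    have hm : 2 * (4 * γ + (4 * γ) ^ 2) * (max r' 0 + ρmin) ≤ 2 * (4 * γ + (4 * γ) ^ 2) * (max r 0 + ρmin) :=
      mul_le_mul_of_nonneg_left hKK (by positivity)
    linarith
  · exact (pow_le_pow_left₀ hK'0 hKK 2).trans h5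

include hΛt hdec huγ hpos hξ hmis hsep hT₀inf hγ1 in
/-- **The admissible clamp profile.** A smooth `ρ ≥ 1`, `ρ → ∞`, such that the clamp radius
`max (ρ s) 0 + ρmin = ρ s + ρmin` is admissible at every late model time `s`. [folklore] -/
theorem exists_admissible_profile (ρmin Tl : ℝ) (hρmin : 0 ≤ ρmin) :
    ∃ ρ : ℝ → ℝ, ContDiff ℝ ∞ ρ ∧ (∀ s, 1 ≤ ρ s) ∧ Tendsto ρ atTop atTop ∧ ∀ᶠ s in atTop,
    (Tl + 1 ≤ T₀ s - 8 * γ * (max (ρ s) 0 + ρmin)) ∧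
    (∀ t, T₀ s ≤ t → ‖deriv (fun t ↦ frameTilt (Λt t)) t‖ * (2 * (max (ρ s) 0 + ρmin)) ≤ 1 / 2) ∧
    (∀ t, T₀ (s - 1) - 8 * γ * (max (ρ s) 0 + ρmin) ≤ t →
      ‖deriv (fun t ↦ frameVel (Λt t) 0) t‖ ≤ 1 / (664 * γ ^ 4 * (1 + 2 * (max (ρ s) 0 + ρmin)) ^ 4 + 1) ∧
      ‖iteratedDeriv 2 (fun t ↦ frameVel (Λt t) 0) t‖ ≤ 1 / (664 * γ ^ 4 * (1 + 2 * (max (ρ s) 0 + ρmin)) ^ 4 + 1) ∧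
      ‖deriv (fun t ↦ frameTilt (Λt t)) t‖ ≤ 1 / (664 * γ ^ 4 * (1 + 2 * (max (ρ s) 0 + ρmin)) ^ 4 + 1) ∧
      ‖iteratedDeriv 2 (fun t ↦ frameTilt (Λt t)) t‖ ≤ 1 / (664 * γ ^ 4 * (1 + 2 * (max (ρ s) 0 + ρmin)) ^ 4 + 1) ∧
      ‖iteratedDeriv 3 (fun t ↦ frameTilt (Λt t)) t‖ ≤ 1 / (664 * γ ^ 4 * (1 + 2 * (max (ρ s) 0 + ρmin)) ^ 4 + 1) ∧
      ‖deriv (fun t ↦ purgedFrame (Λt t)) t‖ ≤ 1 / (664 * γ ^ 4 * (1 + 2 * (max (ρ s) 0 + ρmin)) ^ 4 + 1) ∧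
      ‖iteratedDeriv 2 (fun t ↦ purgedFrame (Λt t)) t‖ ≤ 1 / (664 * γ ^ 4 * (1 + 2 * (max (ρ s) 0 + ρmin)) ^ 4 + 1) ∧
      ‖iteratedDeriv 3 (fun t ↦ purgedFrame (Λt t)) t‖ ≤ 1 / (664 * γ ^ 4 * (1 + 2 * (max (ρ s) 0 + ρmin)) ^ 4 + 1) ∧
      ‖deriv (centrePath (ξ i)) t - normVel (Λt t)‖ ≤ 1 / (664 * γ ^ 4 * (1 + 2 * (max (ρ s) 0 + ρmin)) ^ 4 + 1) ∧
      ‖iteratedDeriv 2 (centrePath (ξ i)) t‖ ≤ 1 / (664 * γ ^ 4 * (1 + 2 * (max (ρ s) 0 + ρmin)) ^ 4 + 1) ∧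
      ‖iteratedDeriv 3 (centrePath (ξ i)) t‖ ≤ 1 / (664 * γ ^ 4 * (1 + 2 * (max (ρ s) 0 + ρmin)) ^ 4 + 1)) ∧
    (∀ t, T₀ s - 8 * γ * (max (ρ s) 0 + ρmin) ≤ t → ∀ j ≠ i,
      2 * (4 * γ + (4 * γ) ^ 2) * (max (ρ s) 0 + ρmin) + Kerr.rPlus (M j) (a j) + |a j| + 1 ≤ ‖ξ i t - ξ j t‖) ∧
    ((max (ρ s) 0 + ρmin) ^ 2 ≤ s) := by
  refine exists_slow_profile (P := fun s r ↦ (Tl + 1 ≤ T₀ s - 8 * γ * (max r 0 + ρmin)) ∧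
    (∀ t, T₀ s ≤ t → ‖deriv (fun t ↦ frameTilt (Λt t)) t‖ * (2 * (max r 0 + ρmin)) ≤ 1 / 2) ∧
    (∀ t, T₀ (s - 1) - 8 * γ * (max r 0 + ρmin) ≤ t →
      ‖deriv (fun t ↦ frameVel (Λt t) 0) t‖ ≤ 1 / (664 * γ ^ 4 * (1 + 2 * (max r 0 + ρmin)) ^ 4 + 1) ∧
      ‖iteratedDeriv 2 (fun t ↦ frameVel (Λt t) 0) t‖ ≤ 1 / (664 * γ ^ 4 * (1 + 2 * (max r 0 + ρmin)) ^ 4 + 1) ∧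
      ‖deriv (fun t ↦ frameTilt (Λt t)) t‖ ≤ 1 / (664 * γ ^ 4 * (1 + 2 * (max r 0 + ρmin)) ^ 4 + 1) ∧
      ‖iteratedDeriv 2 (fun t ↦ frameTilt (Λt t)) t‖ ≤ 1 / (664 * γ ^ 4 * (1 + 2 * (max r 0 + ρmin)) ^ 4 + 1) ∧
      ‖iteratedDeriv 3 (fun t ↦ frameTilt (Λt t)) t‖ ≤ 1 / (664 * γ ^ 4 * (1 + 2 * (max r 0 + ρmin)) ^ 4 + 1) ∧
      ‖deriv (fun t ↦ purgedFrame (Λt t)) t‖ ≤ 1 / (664 * γ ^ 4 * (1 + 2 * (max r 0 + ρmin)) ^ 4 + 1) ∧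
      ‖iteratedDeriv 2 (fun t ↦ purgedFrame (Λt t)) t‖ ≤ 1 / (664 * γ ^ 4 * (1 + 2 * (max r 0 + ρmin)) ^ 4 + 1) ∧
      ‖iteratedDeriv 3 (fun t ↦ purgedFrame (Λt t)) t‖ ≤ 1 / (664 * γ ^ 4 * (1 + 2 * (max r 0 + ρmin)) ^ 4 + 1) ∧
      ‖deriv (centrePath (ξ i)) t - normVel (Λt t)‖ ≤ 1 / (664 * γ ^ 4 * (1 + 2 * (max r 0 + ρmin)) ^ 4 + 1) ∧
      ‖iteratedDeriv 2 (centrePath (ξ i)) t‖ ≤ 1 / (664 * γ ^ 4 * (1 + 2 * (max r 0 + ρmin)) ^ 4 + 1) ∧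
      ‖iteratedDeriv 3 (centrePath (ξ i)) t‖ ≤ 1 / (664 * γ ^ 4 * (1 + 2 * (max r 0 + ρmin)) ^ 4 + 1)) ∧
    (∀ t, T₀ s - 8 * γ * (max r 0 + ρmin) ≤ t → ∀ j ≠ i,
      2 * (4 * γ + (4 * γ) ^ 2) * (max r 0 + ρmin) + Kerr.rPlus (M j) (a j) + |a j| + 1 ≤ ‖ξ i t - ξ j t‖) ∧
    ((max r 0 + ρmin) ^ 2 ≤ s))
    (fun s r r' hrr h ↦ admissible_antitone i M a ξ Λt T₀ hγ1 ρmin Tl hρmin s r r' hrr h) fun n ↦ ?_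
  refine (eventually_admissible i M a ξ Λt T₀ hΛt hdec hγ1 huγ hpos hξ hmis hsep hT₀inf ρmin Tl hρmin n).mono
    fun s hs ↦ ?_
  rw [max_eq_left (Nat.cast_nonneg n)]
  exact hs

end Profile

/-- Registered one-line form (worker carrier `rechart_admissible_bound_antitone`). [folklore] -/
theorem rechart_admissible_bound_antitone : ∀ {γ K K' : ℝ}, 0 ≤ γ → 0 ≤ K' → K' ≤ K → 1 / (664 * γ ^ 4 * (1 + 2 * K) ^ 4 + 1) ≤ 1 / (664 * γ ^ 4 * (1 + 2 * K') ^ 4 + 1) := by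
  intro γ K K' hγ hK' hKK
  refine one_div_le_one_div_of_le (by positivity) ?_
  have : (1 + 2 * K') ^ 4 ≤ (1 + 2 * K) ^ 4 := pow_le_pow_left₀ (by linarith) (by linarith) 4
  nlinarith [pow_nonneg hγ 4]

end Summit.FinalStateConjecture.FinalStateConjecture.Theorems.SublinearIsFree.Rechart

end
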